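import Summits.CriticalPhenomena.SAWScalingLimit.Theses.SAWCompassLattice
import Summits.CriticalPhenomena.SAWScalingLimit.Theorems.SAWDevelopingMapHexTransferPortTransfer
import Summits.CriticalPhenomena.SAWScalingLimit.Theorems.SAWDevelopingMapHexTransferPortDictionary
import Summits.CriticalPhenomena.SAWScalingLimit.Theorems.SAWDevelopingMapHexTransferCompassRealisation
import Summits.CriticalPhenomena.SAWScalingLimit.Theorems.SAWCompassLatticeSurfaceUniversalityNonVacuity
import Literature.Probability.RandomPlanarGeometry.SLEConvergenceCriterion
import Literature.Probability.RandomPlanarGeometry.SLEUniquenessInLaw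

/-!
# Stub `stub_ybCriterion` (crux `CompassSLE`, stmt-CriticalPhenomena-6965, line registered = birth)

The soft step of the lattice-to-SLE scheme for Glazman–Manolescu's critical `π/2` Yang–Baxter walk
(`ybLaw (fun _ => π/2) Ω δ 1 a b`, pushed to `CurveClass ℂ` by `YBWalk.curve`): tightness along
the mesh (`IsTightAlongMesh`) + identification of the probability subsequential limit laws as the
chordal SLE(8/3) law (`IsSLELaw (8/3) D`) ⟹ `ConvergesInLawToSLE (8/3) D`
(Duminil-Copin–Smirnov 2012, proof of Thm. 3.13; Billingsley 1999, Thm. 5.1 and its Corollary).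

The Literature criterion `convergesInLawToSLE_of_isTightAlongMesh` wants probability laws `P δ`
at EVERY mesh `δ`, while `ybLaw` is a probability measure only EVENTUALLY along `𝓝[>] 0` (junk
value `0` when the partition function vanishes or is infinite). Contents:

* `eventually_isProbabilityMeasure_ybLaw` — for a Dobrushin domain and a port endpoint
  approximation at `Θ ≡ π/2`, `ybLaw (π/2) D.carrier δ 1 (a δ) (b δ)` is a probability measure
  for all small `δ > 0`. Route: by the LANDED port dictionary (`stub_portDictionary`) and compass
  realisation (`stub_compassRealisation`), GM's law is the push-forward of the normalised compass
  path measure `compassRho` along `toYB` (`PortTransfer.ybLaw_eq_map`); `compassRho` is `0` or a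
  probability measure (`compassRho_zero_or_prob`), and the first case is excluded eventually since
  the compass chordal law `compassLaw = compassRho.map (compassCurve δ)` is eventually a
  probability measure (`Surface.eventually_isProbabilityMeasure_compassLaw`; the two spellings of
  `compassLaw`, in `PortGadgetLattice.lean` and in `…PortTransferCompass.lean`, agree by `rfl`).
* `convergesInLawToSLE_of_eventually_isProbabilityMeasure` — the criterion with
  `IsProbabilityMeasure (P δ)` only eventually: push the laws to the fixed space `CurveClass ℂ`,
  patch the junk meshes by a Dirac law (tightness, subsequential limits and `TendstoLaw` only see
  `𝓝[>] 0`), apply the Literature criterion with the proved uniqueness of the SLE law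
  (`IsSLECurve.map_eq_holds`), and transfer back (`integral_map`).
* `stub_ybCriterion` — the registered stub signature, verbatim.
-/

noncomputable section

namespace Summit.CriticalPhenomena.SAWScalingLimit.Theorems.SAWCompassLatticeCompassSLE

open MeasureTheory Filter Topology Set
open scoped NNReal ENNReal BoundedContinuousFunction
open Literature.Probability.RandomPlanarGeometry
open Literature.Probability.RandomPlanarGeometry.SAW.YangBaxter
open Summit.CriticalPhenomena.SAWScalingLimit.Theses
open Summit.CriticalPhenomena.SAWScalingLimit.Cruxes.HexTransfer.Sketch

/-! ### GM's `π/2` law is eventually a probability measure -/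

/-- **GM's critical `π/2` Yang–Baxter law is a probability measure for all small `δ > 0`**, in a
Dobrushin domain with a port endpoint approximation. By the port dictionary and the compass
realisation (both landed), `ybLaw (π/2) Ω δ 1 a b` is the push-forward along `toYB` of the
normalised compass path measure, which is `0` or a probability measure; it is not `0` as soon as
the compass chordal law (its push-forward along the drawing map) is a probability measure, which
holds eventually (`Surface.eventually_isProbabilityMeasure_compassLaw`). -/
theorem eventually_isProbabilityMeasure_ybLaw (D : DobrushinDomain) {a b : ℝ → MidEdge}
    (hab : IsYBEndpointApprox (fun (_ : ℤ) => Real.pi / 2) D a b) :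
    ∀ᶠ δ in 𝓝[>] (0 : ℝ),
      IsProbabilityMeasure (ybLaw (fun (_ : ℤ) => Real.pi / 2) D.carrier δ 1 (a δ) (b δ)) := by
  obtain ⟨α, β, s, z, hsol⟩ := stub_compassRealisation
  have hP : SAWCompassLattice.PortDictionary := stub_portDictionary
  filter_upwards [Surface.eventually_isProbabilityMeasure_compassLaw hsol.1 hsol.2.1 hsol.2.2.1
    hsol.2.2.2.1 D hab] with δ hδ
  -- the normalised compass path measure is a probability measure
  have hρ : IsProbabilityMeasure (PortTransfer.compassRho α β s z D.carrier δ (a δ) (b δ)) := by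
    rcases PortTransfer.compassRho_zero_or_prob α β s z D.carrier δ (a δ) (b δ) with h0 | h
    · exfalso
      -- the two spellings of the compass chordal law agree definitionally
      have h1 : PortTransfer.compassLaw α β s z D.carrier δ (a δ) (b δ) Set.univ = 1 :=
        hδ.measure_univ
      rw [PortTransfer.compassLaw_eq_map, h0, Measure.map_zero, Measure.coe_zero,
        Pi.zero_apply] at h1
      exact zero_ne_one h1
    · exact h
  rw [PortTransfer.ybLaw_eq_map hP hsol]
  exact Measure.isProbabilityMeasure_map (PortTransfer.measurable_cpath _).aemeasurable

/-! ### The criterion with eventually-probability laws -/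

/-- **Convergence to SLE_κ from tightness and identification, for laws that are probability
measures only eventually.** Let `Y δ : Ωδ δ → CurveClass ℂ` be a.e.-measurable random curves
under laws `P δ` which are probability measures for all small `δ > 0`. If the family is tight
along the mesh and every probability subsequential limit law is a chordal SLE_κ law in `D`, then
`Y δ` converges in law to chordal SLE_κ. Proof: the push-forward laws `(P δ).map (Y δ)` on the
fixed Polish space `CurveClass ℂ`, patched by a Dirac law at the meshes where `P δ` is not a
probability measure, satisfy the hypotheses of `convergesInLawToSLE_of_isTightAlongMesh` (with
the proved uniqueness `IsSLECurve.map_eq_holds`); all notions involved only see the filter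
`𝓝[>] 0`, along which the patched laws are the honest push-forwards (`integral_map`). -/
theorem convergesInLawToSLE_of_eventually_isProbabilityMeasure {κ : ℝ≥0} {D : DobrushinDomain}
    {Ωδ : ℝ → Type*} [∀ δ, MeasurableSpace (Ωδ δ)] {Y : ∀ δ, Ωδ δ → CurveClass ℂ}
    {P : ∀ δ, Measure (Ωδ δ)} (hP : ∀ᶠ δ in 𝓝[>] (0 : ℝ), IsProbabilityMeasure (P δ))
    (hY : ∀ δ, AEMeasurable (Y δ) (P δ)) (hT : IsTightAlongMesh Y P)
    (hL : ∀ μ : Measure (CurveClass ℂ), IsProbabilityMeasure μ → IsSubseqLimitLaw Y P μ →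
      IsSLELaw κ D μ) :
    ConvergesInLawToSLE κ D Y P := by
  classical
  -- the patched push-forward laws on the fixed space `CurveClass ℂ`
  let ν : ℝ → Measure (CurveClass ℂ) := fun δ =>
    if IsProbabilityMeasure (P δ) then (P δ).map (Y δ)
    else Measure.dirac (CurveClass.mk (Curve.const 0))
  have hν : ∀ᶠ δ in 𝓝[>] (0 : ℝ), ν δ = (P δ).map (Y δ) := hP.mono fun δ hδ => if_pos hδ
  haveI hνprob : ∀ δ, IsProbabilityMeasure (ν δ) := fun δ => by
    dsimp only [ν]
    split_ifs with hδ
    · exact Measure.isProbabilityMeasure_map (hY δ)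
    · infer_instance
  -- along the mesh filter the patched laws integrate test functions honestly
  have hint : ∀ᶠ δ in 𝓝[>] (0 : ℝ), ∀ f : CurveClass ℂ →ᵇ ℝ,
      ∫ x, f x ∂(ν δ) = ∫ ω, f (Y δ ω) ∂(P δ) := by
    filter_upwards [hν] with δ hδ f
    rw [hδ, integral_map (hY δ) f.continuous.aestronglyMeasurable]
  -- tightness transfers to the fixed space
  have hT' : IsTightAlongMesh (Ωδ := fun (_ : ℝ) => CurveClass ℂ)
      (fun (_ : ℝ) => (id : CurveClass ℂ → CurveClass ℂ)) ν := by
    intro ε hε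
    obtain ⟨K, hK, hevK⟩ := hT ε hε
    refine ⟨K, hK, ?_⟩
    filter_upwards [hevK, hν] with δ hδK hδ
    rw [hδ, Set.preimage_id,
      Measure.map_apply_of_aemeasurable (hY δ) hK.isClosed.isOpen_compl.measurableSet]
    exact hδK
  -- identification of the subsequential limits transfers to the fixed space
  have hL' : ∀ μ : Measure (CurveClass ℂ), IsProbabilityMeasure μ →
      IsSubseqLimitLaw (Ωδ := fun (_ : ℝ) => CurveClass ℂ)
        (fun (_ : ℝ) => (id : CurveClass ℂ → CurveClass ℂ)) ν μ → IsSLELaw κ D μ := by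
    rintro μ hμ ⟨s, hs, hlim⟩
    refine hL μ hμ ⟨s, hs, fun f => ?_⟩
    exact (hlim f).congr' ((hs.eventually hint).mono fun n hn => hn f)
  -- the Literature criterion on the fixed space, with the proved uniqueness of the SLE law
  obtain ⟨Γ, hΓ, -, hTL⟩ := convergesInLawToSLE_of_isTightAlongMesh
    (Ωδ := fun (_ : ℝ) => CurveClass ℂ) (Y := fun (_ : ℝ) => (id : CurveClass ℂ → CurveClass ℂ))
    (P := ν) IsSLECurve.map_eq_holds (Eventually.of_forall fun _ => aemeasurable_id) hT' hL'
  -- and back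
  refine ⟨Γ, hΓ, Eventually.of_forall fun δ => hY δ, fun f => ?_⟩
  exact (hTL f).congr' (hint.mono fun δ hδ => hδ f)

/-! ### The stub -/

/-- **Stub `stub_ybCriterion` (the soft step for GM's `π/2` walk).** Tightness along the mesh +
identification of the probability subsequential limit laws as the chordal SLE(8/3) law ⟹
`ConvergesInLawToSLE (8/3) D` for `ybLaw (fun _ => π/2) D.carrier δ 1 (a δ) (b δ)` pushed to
`CurveClass ℂ` by `YBWalk.curve` (Duminil-Copin–Smirnov 2012, proof of Thm. 3.13; Billingsley
1999, Thm. 5.1, Corollary), the laws being probability measures eventually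
(`eventually_isProbabilityMeasure_ybLaw`) and the observable measurable
(`YBWalk.aemeasurable_curve`). -/
theorem stub_ybCriterion :
    ∀ (D : DobrushinDomain) (a b : ℝ → MidEdge),
      IsYBEndpointApprox (fun (_ : ℤ) => Real.pi / 2) D a b →
      IsTightAlongMesh
        (fun δ (γ : YangBaxterSAW (fun (_ : ℤ) => Real.pi / 2) D.carrier δ (a δ) (b δ)) =>
          γ.curve (fun (_ : ℤ) => Real.pi / 2) δ)
        (fun δ => ybLaw (fun (_ : ℤ) => Real.pi / 2) D.carrier δ 1 (a δ) (b δ)) →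
      (∀ μ : Measure (CurveClass ℂ), IsProbabilityMeasure μ →
        IsSubseqLimitLaw
          (fun δ (γ : YangBaxterSAW (fun (_ : ℤ) => Real.pi / 2) D.carrier δ (a δ) (b δ)) =>
            γ.curve (fun (_ : ℤ) => Real.pi / 2) δ)
          (fun δ => ybLaw (fun (_ : ℤ) => Real.pi / 2) D.carrier δ 1 (a δ) (b δ)) μ →
        IsSLELaw ((8 : NNReal) / 3) D μ) →
      ConvergesInLawToSLE ((8 : NNReal) / 3) D
        (fun δ (γ : YangBaxterSAW (fun (_ : ℤ) => Real.pi / 2) D.carrier δ (a δ) (b δ)) =>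
          γ.curve (fun (_ : ℤ) => Real.pi / 2) δ)
        (fun δ => ybLaw (fun (_ : ℤ) => Real.pi / 2) D.carrier δ 1 (a δ) (b δ)) := by
  intro D a b hab hT hI
  exact convergesInLawToSLE_of_eventually_isProbabilityMeasure
    (eventually_isProbabilityMeasure_ybLaw D hab)
    (fun δ => YBWalk.aemeasurable_curve _ _ δ 1 (a δ) (b δ)) hT hI

end Summit.CriticalPhenomena.SAWScalingLimit.Theorems.SAWCompassLatticeCompassSLE

end
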